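import Summits.Ventures.LatticeQCDFlow.Exactness.IMHCoupledUnbiasedEstimatorMSE
import Summits.Ventures.LatticeQCDFlow.Scoring.ReplicaChains
import HarnessLib

/-!
# Embarrassingly parallel and (almost) unbiased: `R` independent coupled pairs divide the whole mean-square error by `R`,
# up to the squared truncation bias `((1 − A)^{k+N}(c − a))²` — which is zero at `N = ∞`

HONEST FRAMING: exact (Metropolis-corrected) sampling algorithms for lattice gauge theory;
figures of merit are autocorrelation/cost numbers at stated couplings and volumes; no
continuum-physics claim.

Venture `LatticeQCDFlow` (cell pub-lqcd), topic `Exactness`; FANOUT row 30 (lean-1, GEN-37).  NEW WORK of the cell,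
general state space; sequel to `Exactness/IMHCoupledUnbiasedEstimator{Variance,MSE}` (this generation) with the Scoring row's
replica algebra (`Scoring/ReplicaChains`: pairwise-uncorrelated replica means, median-of-means amplification).  Setting:
`K = indepMH q w` (`w` measurable — a `Fact` —, positive, normalised, maximal at `x₀`, `W = w(x₀) = 1/A`, `r = 1 − A`), a CRN pair
kernel `K̂`, `a ≤ f ≤ c` measurable, `Var_π f = ∫ (f − π f)² dπ`; the truncated coupled estimator of a pair stream `ẑ`,
`H(ẑ) = f(Y_k) + Σ_{n<N}(f(X′_{k+n}) − f(Y_{k+n}))`.  On a probability space carrying `R ≥ 1` replicas `Z_0, …, Z_{R−1}` of the pair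
stream — `Z_j` distributed as the CRN pair chain from its own initial coupling `μ̂_j` (one update ahead in its first coordinate)
— the practitioner reports the grand mean `H̄ = (1/R)Σ_j H(Z_j)`:

* §1 per replica (transfer of V1 ∕ V2 along the law): **`crnLag_replica_bias_abs_le`** — `|E H(Z_j) − π f| ≤ r^{k+N}(c − a)`;
  **`crnLag_replica_sq_le`** — `E(H(Z_j) − π f)² ≤ Var_π f + r^k(c − a)²(2W² + W + 1)`; **`memLp_crnLag_replica`** — `H(Z_j) ∈ L²`.
* §2 **`crnLag_replicas_mse_le`** — PAIRWISE INDEPENDENT replicas: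
  `E(H̄ − π f)² ≤ [Var_π f + r^k(c − a)²(2W² + W + 1)]/R + (1 − 1/R)·(r^{k+N}(c − a))²` — REPLICATION DIVIDES EVERYTHING EXCEPT THE
  SQUARED TRUNCATION BIAS, itself geometrically small in the total work `k + N` per replica (and ZERO for the untruncated estimator,
  GEN-36's exact unbiasedness): no bias floor, unlike pooled burned-in averages (GEN-35 `IMHAnyStartReplicas`: floor
  `(D r^b S_N/N)²` from the start, removed only by discarding).
* §3 **`crnLag_replicas_median`** — MUTUALLY INDEPENDENT replicas and `4[Var_π f + r^k(c − a)²(2W² + W + 1)] ≤ s²` ⇒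
  `P(#{j < R : |H(Z_j) − π f| ≥ s} ≥ R/2) ≤ exp(−R/8)`: the median of the `R` coupled estimates is within `s` of `π f` with
  probability `≥ 1 − e^{−R/8}` (confidence without a variance estimate).
Reading (gauge files): run `R` independent coupled pairs of the exact gauge sampler, each for `k + N` updates, and average:
error `≈ √((Var_π f + (1 − A)^k·const)/R)` with a bias at most `(1 − A)^{k+N}(c − a)` — wall-clock `k + N`, not `R(k + N)`.
NOT CLAIMED: the between-replica variance ESTIMATOR and its confidence interval; optimal `(k, N, R)` at fixed budget; anything for
unbounded `f`.  No `sorry`, no new definitions, nothing cited as a fact.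
-/

noncomputable section

namespace Summit.Ventures.LatticeQCDFlow.Exactness

open MeasureTheory ProbabilityTheory Function Finset
open scoped ENNReal unitInterval
open Summit.Ventures.LatticeQCDFlow.Scoring

variable {Ω : Type*} [MeasurableSpace Ω] {q : Measure Ω} [IsProbabilityMeasure q] {w : Ω → ℝ}

/-! ## §0 Bookkeeping: the coupled estimator is a bounded measurable statistic of the pair stream -/

omit [IsProbabilityMeasure q] in
/-- `ẑ ↦ f(Y_k) + Σ_{n<N}(f(X′_{k+n}) − f(Y_{k+n}))` is measurable on pair-path space. [ours, bookkeeping] -/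
theorem measurable_crnLagEstimator {f : Ω → ℝ} (hf : Measurable f) (k N : ℕ) :
    Measurable fun z : ℕ → Ω × Ω => f ((z k).2) + ∑ n ∈ range N, (f ((z (k + n)).1) - f ((z (k + n)).2)) :=
  (hf.comp (measurable_snd.comp (measurable_pi_apply k))).add (Finset.measurable_sum _ fun n _ =>
    (hf.comp (measurable_fst.comp (measurable_pi_apply (k + n)))).sub
      (hf.comp (measurable_snd.comp (measurable_pi_apply (k + n)))))

omit [MeasurableSpace Ω] [IsProbabilityMeasure q] in
/-- `|f(Y_k) + Σ_{n<N} D_{k+n}| ≤ max|a||c| + N(c − a)` for `a ≤ f ≤ c`. [ours, bookkeeping] -/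
theorem abs_crnLagEstimator_le {f : Ω → ℝ} {a c : ℝ} (ha : ∀ x, a ≤ f x) (hc : ∀ x, f x ≤ c) (k N : ℕ)
    (z : ℕ → Ω × Ω) :
    |f ((z k).2) + ∑ n ∈ range N, (f ((z (k + n)).1) - f ((z (k + n)).2))| ≤ max |a| |c| + N * (c - a) := by
  refine (abs_add_le _ _).trans (add_le_add (abs_le_max_abs_abs (ha _) (hc _)) ?_)
  refine (abs_sum_le_sum_abs _ _).trans ?_
  calc ∑ n ∈ range N, |f ((z (k + n)).1) - f ((z (k + n)).2)| ≤ ∑ n ∈ range N, (c - a) :=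
        sum_le_sum fun n _ => by
          have h1 := ha ((z (k + n)).1); have h2 := hc ((z (k + n)).1)
          have h3 := ha ((z (k + n)).2); have h4 := hc ((z (k + n)).2)
          exact abs_le.2 ⟨by linarith, by linarith⟩
    _ = N * (c - a) := by rw [sum_const, card_range, nsmul_eq_mul]

section Replicas

variable {Ω' : Type*} {mΩ' : MeasurableSpace Ω'} {μ : Measure Ω'} [IsProbabilityMeasure μ]
  {Z : ℕ → Ω' → (ℕ → Ω × Ω)} {ν₀ : ℕ → Measure (Ω × Ω)} [∀ j, IsProbabilityMeasure (ν₀ j)] {R : ℕ}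

omit [IsProbabilityMeasure q] [IsProbabilityMeasure μ] [∀ j, IsProbabilityMeasure (ν₀ j)] in
/-- A replica of the coupled estimator is square integrable. [ours, bookkeeping] -/
theorem memLp_crnLag_replica {f : Ω → ℝ} (hf : Measurable f) {a c : ℝ} (ha : ∀ x, a ≤ f x) (hc : ∀ x, f x ≤ c)
    (k N : ℕ) [IsFiniteMeasure μ] (hZm : ∀ j, Measurable (Z j)) (j : ℕ) :
    MemLp (fun ω => f ((Z j ω k).2) + ∑ n ∈ range N, (f ((Z j ω (k + n)).1) - f ((Z j ω (k + n)).2))) 2 μ :=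
  MemLp.of_bound (((measurable_crnLagEstimator hf k N).comp (hZm j)).aestronglyMeasurable) (max |a| |c| + N * (c - a))
    (ae_of_all _ fun ω => by
      rw [Real.norm_eq_abs]
      exact abs_crnLagEstimator_le ha hc k N (Z j ω))

/-! ## §1 Per replica: bias and second moment, transferred along the law -/

omit [IsProbabilityMeasure μ] in
/-- **Per replica, the bias**: `|E H(Z_j) − π f| ≤ r^{k+N}(c − a)` when `Z_j` is distributed as the CRN pair chain from a coupling
one update ahead in its first coordinate. [ours] -/
theorem crnLag_replica_bias_abs_le [Fact (Measurable w)] (hw0 : ∀ y, 0 < w y) {x₀ : Ω} (hmax : ∀ y, w y ≤ w x₀)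
    [IsProbabilityMeasure (q.withDensity fun y => ENNReal.ofReal (w y))]
    (Khat : Kernel (Ω × Ω) (Ω × Ω)) [IsMarkovKernel Khat]
    (hK : ∀ z : Ω × Ω, Khat z = (q.prod (volume : Measure unitInterval)).map (fun p : Ω × unitInterval =>
      ((if (p.2 : ℝ) * w z.1 ≤ w p.1 then p.1 else z.1), (if (p.2 : ℝ) * w z.2 ≤ w p.1 then p.1 else z.2))))
    {f : Ω → ℝ} (hf : Measurable f) {a c : ℝ} (ha : ∀ x, a ≤ f x) (hc : ∀ x, f x ≤ c) (k N : ℕ)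
    (hZm : ∀ j, Measurable (Z j)) {j : ℕ}
    (hlaw : μ.map (Z j) = Kernel.trajMeasure (X := fun _ : ℕ => Ω × Ω) (ν₀ j)
      (fun n : ℕ => Khat.comap (fun h : (i : ↥(Finset.Iic n)) → Ω × Ω => h ⟨n, Finset.mem_Iic.2 le_rfl⟩)
        (measurable_pi_apply _)))
    (hlag : (ν₀ j).map Prod.fst = ((ν₀ j).map Prod.snd).bind (indepMH q w)) :
    |∫ ω, (f ((Z j ω k).2) + ∑ n ∈ range N, (f ((Z j ω (k + n)).1) - f ((Z j ω (k + n)).2))) ∂μ -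
        ∫ x, f x ∂(q.withDensity fun y => ENNReal.ofReal (w y))| ≤ (1 - (w x₀)⁻¹) ^ (k + N) * (c - a) := by
  rw [integral_comp_eq_of_map_eq (hZm j) hlaw (measurable_crnLagEstimator hf k N)]
  exact crnLag_truncated_bias_abs_le hw0 hmax Khat hK (ν₀ j) hlag hf ha hc k N

omit [IsProbabilityMeasure μ] in
/-- **Per replica, the second moment about `π f`**: `E(H(Z_j) − π f)² ≤ Var_π f + r^k(c − a)²(2W² + W + 1)` (any initial coupling).
[ours] -/
theorem crnLag_replica_sq_le [Fact (Measurable w)] (hw0 : ∀ y, 0 < w y) {x₀ : Ω} (hmax : ∀ y, w y ≤ w x₀)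
    [IsProbabilityMeasure (q.withDensity fun y => ENNReal.ofReal (w y))]
    (Khat : Kernel (Ω × Ω) (Ω × Ω)) [IsMarkovKernel Khat]
    (hK : ∀ z : Ω × Ω, Khat z = (q.prod (volume : Measure unitInterval)).map (fun p : Ω × unitInterval =>
      ((if (p.2 : ℝ) * w z.1 ≤ w p.1 then p.1 else z.1), (if (p.2 : ℝ) * w z.2 ≤ w p.1 then p.1 else z.2))))
    {f : Ω → ℝ} (hf : Measurable f) {a c : ℝ} (ha : ∀ x, a ≤ f x) (hc : ∀ x, f x ≤ c) (k N : ℕ)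
    (hZm : ∀ j, Measurable (Z j)) {j : ℕ}
    (hlaw : μ.map (Z j) = Kernel.trajMeasure (X := fun _ : ℕ => Ω × Ω) (ν₀ j)
      (fun n : ℕ => Khat.comap (fun h : (i : ↥(Finset.Iic n)) → Ω × Ω => h ⟨n, Finset.mem_Iic.2 le_rfl⟩)
        (measurable_pi_apply _))) :
    ∫ ω, (f ((Z j ω k).2) + ∑ n ∈ range N, (f ((Z j ω (k + n)).1) - f ((Z j ω (k + n)).2)) -
          ∫ x, f x ∂(q.withDensity fun y => ENNReal.ofReal (w y))) ^ 2 ∂μ ≤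
      ∫ y, (f y - ∫ x, f x ∂(q.withDensity fun y => ENNReal.ofReal (w y))) ^ 2
          ∂(q.withDensity fun y => ENNReal.ofReal (w y)) +
        (1 - (w x₀)⁻¹) ^ k * (c - a) ^ 2 * (2 * w x₀ ^ 2 + w x₀ + 1) := by
  rw [integral_comp_eq_of_map_eq (hZm j) hlaw
    (φ := fun z : ℕ → Ω × Ω => (f ((z k).2) + ∑ n ∈ range N, (f ((z (k + n)).1) - f ((z (k + n)).2)) -
      ∫ x, f x ∂(q.withDensity fun y => ENNReal.ofReal (w y))) ^ 2)
    (((measurable_crnLagEstimator hf k N).sub measurable_const).pow_const 2)]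
  exact crnLag_truncated_sq_le_variance' hw0 hmax Khat hK (ν₀ j) hf ha hc k N

/-! ## §2 The grand mean of pairwise independent coupled pairs -/

/-- **EMBARRASSINGLY PARALLEL COUPLED ESTIMATION.**  `w` measurable (a `Fact`), positive, normalised, maximal at `x₀`
(`W = w(x₀)`, `r = 1 − 1/W`); `K̂` a CRN pair kernel; `a ≤ f ≤ c` measurable; `R ≥ 1`.  On a probability space carrying pairwise
independent pair streams `Z_0, …, Z_{R−1}`, `Z_j` distributed as the CRN pair chain from an initial coupling `μ̂_j` one update
ahead in its first coordinate, the grand mean `H̄` of the coupled estimators `H(Z_j) = f(Y_k) + Σ_{n<N}(f(X′_{k+n}) − f(Y_{k+n}))`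
has `E(H̄ − π f)² ≤ [Var_π f + r^k(c − a)²(2W² + W + 1)]/R + (1 − 1/R)·(r^{k+N}(c − a))²`. [ours] -/
theorem crnLag_replicas_mse_le [Fact (Measurable w)] (hw0 : ∀ y, 0 < w y) {x₀ : Ω} (hmax : ∀ y, w y ≤ w x₀)
    [IsProbabilityMeasure (q.withDensity fun y => ENNReal.ofReal (w y))]
    (Khat : Kernel (Ω × Ω) (Ω × Ω)) [IsMarkovKernel Khat]
    (hK : ∀ z : Ω × Ω, Khat z = (q.prod (volume : Measure unitInterval)).map (fun p : Ω × unitInterval =>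
      ((if (p.2 : ℝ) * w z.1 ≤ w p.1 then p.1 else z.1), (if (p.2 : ℝ) * w z.2 ≤ w p.1 then p.1 else z.2))))
    {f : Ω → ℝ} (hf : Measurable f) {a c : ℝ} (ha : ∀ x, a ≤ f x) (hc : ∀ x, f x ≤ c) (k N : ℕ) (hR : R ≠ 0)
    (hZm : ∀ j, Measurable (Z j))
    (hlaw : ∀ j < R, μ.map (Z j) = Kernel.trajMeasure (X := fun _ : ℕ => Ω × Ω) (ν₀ j)
      (fun n : ℕ => Khat.comap (fun h : (i : ↥(Finset.Iic n)) → Ω × Ω => h ⟨n, Finset.mem_Iic.2 le_rfl⟩)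
        (measurable_pi_apply _)))
    (hlag : ∀ j < R, (ν₀ j).map Prod.fst = ((ν₀ j).map Prod.snd).bind (indepMH q w))
    (hind : ∀ i < R, ∀ j < R, i ≠ j → IndepFun (Z i) (Z j) μ) :
    ∫ ω, (replicaMean (fun j ω => f ((Z j ω k).2) + ∑ n ∈ range N, (f ((Z j ω (k + n)).1) - f ((Z j ω (k + n)).2))) R ω -
        ∫ x, f x ∂(q.withDensity fun y => ENNReal.ofReal (w y))) ^ 2 ∂μ ≤
      (∫ y, (f y - ∫ x, f x ∂(q.withDensity fun y => ENNReal.ofReal (w y))) ^ 2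
          ∂(q.withDensity fun y => ENNReal.ofReal (w y)) +
        (1 - (w x₀)⁻¹) ^ k * (c - a) ^ 2 * (2 * w x₀ ^ 2 + w x₀ + 1)) / R +
      (1 - 1 / R) * ((1 - (w x₀)⁻¹) ^ (k + N) * (c - a)) ^ 2 := by
  set m := ∫ x, f x ∂(q.withDensity fun y => ENNReal.ofReal (w y)) with hm
  have hHm : Measurable fun z : ℕ → Ω × Ω => f ((z k).2) + ∑ n ∈ range N, (f ((z (k + n)).1) - f ((z (k + n)).2)) :=
    measurable_crnLagEstimator hf k N
  have hY2 : ∀ j < R, MemLp (fun ω => f ((Z j ω k).2) + ∑ n ∈ range N, (f ((Z j ω (k + n)).1) - f ((Z j ω (k + n)).2))) 2 μ :=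
    fun j _ => memLp_crnLag_replica hf ha hc k N hZm j
  have hb : ∀ j < R, |μ[fun ω => f ((Z j ω k).2) + ∑ n ∈ range N, (f ((Z j ω (k + n)).1) - f ((Z j ω (k + n)).2))] - m| ≤
      (1 - (w x₀)⁻¹) ^ (k + N) * (c - a) := fun j hj =>
    crnLag_replica_bias_abs_le hw0 hmax Khat hK hf ha hc k N hZm (hlaw j hj) (hlag j hj)
  have hv : ∀ j < R, ∫ ω, (f ((Z j ω k).2) + ∑ n ∈ range N, (f ((Z j ω (k + n)).1) - f ((Z j ω (k + n)).2)) - m) ^ 2 ∂μ ≤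
      ∫ y, (f y - m) ^ 2 ∂(q.withDensity fun y => ENNReal.ofReal (w y)) +
        (1 - (w x₀)⁻¹) ^ k * (c - a) ^ 2 * (2 * w x₀ ^ 2 + w x₀ + 1) := fun j hj =>
    crnLag_replica_sq_le hw0 hmax Khat hK hf ha hc k N hZm (hlaw j hj)
  have hcov : ∀ i < R, ∀ j < R, i ≠ j →
      cov[fun ω => f ((Z i ω k).2) + ∑ n ∈ range N, (f ((Z i ω (k + n)).1) - f ((Z i ω (k + n)).2)),
        fun ω => f ((Z j ω k).2) + ∑ n ∈ range N, (f ((Z j ω (k + n)).1) - f ((Z j ω (k + n)).2)); μ] = 0 :=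
    fun i hi j hj hij => ((hind i hi j hj hij).comp hHm hHm).covariance_eq_zero (hY2 i hi) (hY2 j hj)
  exact integral_replicaMean_sub_sq_le
    (Y := fun j ω => f ((Z j ω k).2) + ∑ n ∈ range N, (f ((Z j ω (k + n)).1) - f ((Z j ω (k + n)).2))) hR hY2 hcov hb hv

/-- **THE LAG AND TRUNCATION RULE FOR `R` COUPLED PAIRS**: if `log((2W² + W + 1)/ε) ≤ k/W` then
`E(H̄ − π f)² ≤ [Var_π f + ε(c − a)²]/R + (1 − 1/R)·(r^{k+N}(c − a))²`. [ours] -/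
theorem crnLag_replicas_mse_le_of_log_le [Fact (Measurable w)] (hw0 : ∀ y, 0 < w y) {x₀ : Ω} (hmax : ∀ y, w y ≤ w x₀)
    [IsProbabilityMeasure (q.withDensity fun y => ENNReal.ofReal (w y))]
    (Khat : Kernel (Ω × Ω) (Ω × Ω)) [IsMarkovKernel Khat]
    (hK : ∀ z : Ω × Ω, Khat z = (q.prod (volume : Measure unitInterval)).map (fun p : Ω × unitInterval =>
      ((if (p.2 : ℝ) * w z.1 ≤ w p.1 then p.1 else z.1), (if (p.2 : ℝ) * w z.2 ≤ w p.1 then p.1 else z.2))))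
    {f : Ω → ℝ} (hf : Measurable f) {a c : ℝ} (ha : ∀ x, a ≤ f x) (hc : ∀ x, f x ≤ c) {k : ℕ} (N : ℕ) (hR : R ≠ 0)
    (hZm : ∀ j, Measurable (Z j))
    (hlaw : ∀ j < R, μ.map (Z j) = Kernel.trajMeasure (X := fun _ : ℕ => Ω × Ω) (ν₀ j)
      (fun n : ℕ => Khat.comap (fun h : (i : ↥(Finset.Iic n)) → Ω × Ω => h ⟨n, Finset.mem_Iic.2 le_rfl⟩)
        (measurable_pi_apply _)))
    (hlag : ∀ j < R, (ν₀ j).map Prod.fst = ((ν₀ j).map Prod.snd).bind (indepMH q w))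
    (hind : ∀ i < R, ∀ j < R, i ≠ j → IndepFun (Z i) (Z j) μ) {ε : ℝ} (hε : 0 < ε)
    (hk : Real.log ((2 * w x₀ ^ 2 + w x₀ + 1) / ε) ≤ k * (w x₀)⁻¹) :
    ∫ ω, (replicaMean (fun j ω => f ((Z j ω k).2) + ∑ n ∈ range N, (f ((Z j ω (k + n)).1) - f ((Z j ω (k + n)).2))) R ω -
        ∫ x, f x ∂(q.withDensity fun y => ENNReal.ofReal (w y))) ^ 2 ∂μ ≤
      (∫ y, (f y - ∫ x, f x ∂(q.withDensity fun y => ENNReal.ofReal (w y))) ^ 2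
          ∂(q.withDensity fun y => ENNReal.ofReal (w y)) + ε * (c - a) ^ 2) / R +
      (1 - 1 / R) * ((1 - (w x₀)⁻¹) ^ (k + N) * (c - a)) ^ 2 := by
  have h := crnLag_replicas_mse_le hw0 hmax Khat hK hf ha hc k N hR hZm hlaw hlag hind
  have hW : 1 ≤ w x₀ := one_le_of_mode (q := q) hmax
  have hWpos : 0 < w x₀ := hw0 x₀
  have hr0 : 0 ≤ 1 - (w x₀)⁻¹ := sub_nonneg.2 (inv_le_one_of_one_le₀ hW)
  have hCpos : 0 < 2 * w x₀ ^ 2 + w x₀ + 1 := by positivity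
  have hRpos : (0 : ℝ) < R := by exact_mod_cast Nat.pos_of_ne_zero hR
  have hrk : (1 - (w x₀)⁻¹) ^ k * (2 * w x₀ ^ 2 + w x₀ + 1) ≤ ε := by
    have h1 : (1 - (w x₀)⁻¹) ^ k ≤ Real.exp (-(k * (w x₀)⁻¹)) := by
      calc (1 - (w x₀)⁻¹) ^ k ≤ Real.exp (-(w x₀)⁻¹) ^ k := by
            refine pow_le_pow_left₀ hr0 ?_ k
            have := Real.add_one_le_exp (-(w x₀)⁻¹)
            linarith
        _ = Real.exp (-(k * (w x₀)⁻¹)) := by rw [← Real.exp_nat_mul]; ring_nf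
    have h2 : Real.exp (-(k * (w x₀)⁻¹)) ≤ ε / (2 * w x₀ ^ 2 + w x₀ + 1) := by
      calc Real.exp (-(k * (w x₀)⁻¹)) ≤ Real.exp (-Real.log ((2 * w x₀ ^ 2 + w x₀ + 1) / ε)) :=
            Real.exp_le_exp.2 (neg_le_neg hk)
        _ = ε / (2 * w x₀ ^ 2 + w x₀ + 1) := by
            rw [Real.exp_neg, Real.exp_log (by positivity), inv_div]
    have := h1.trans h2
    rwa [le_div_iff₀ hCpos] at this
  have hmono : (∫ y, (f y - ∫ x, f x ∂(q.withDensity fun y => ENNReal.ofReal (w y))) ^ 2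
        ∂(q.withDensity fun y => ENNReal.ofReal (w y)) +
        (1 - (w x₀)⁻¹) ^ k * (c - a) ^ 2 * (2 * w x₀ ^ 2 + w x₀ + 1)) / R ≤
      (∫ y, (f y - ∫ x, f x ∂(q.withDensity fun y => ENNReal.ofReal (w y))) ^ 2
        ∂(q.withDensity fun y => ENNReal.ofReal (w y)) + ε * (c - a) ^ 2) / R := by
    refine div_le_div_of_nonneg_right ?_ hRpos.le
    nlinarith [sq_nonneg (c - a), mul_le_mul_of_nonneg_left hrk (sq_nonneg (c - a))]
  linarith

/-! ## §3 The median of mutually independent coupled pairs -/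

/-- **MEDIAN OF `R` COUPLED ESTIMATES**: mutually independent replicas and `4·[Var_π f + r^k(c − a)²(2W² + W + 1)] ≤ s²` ⇒
`P(#{j < R : |H(Z_j) − π f| ≥ s} ≥ R/2) ≤ exp(−R/8)` — the sample median of the `R` coupled estimates is within `s` of `π f`
with probability `≥ 1 − e^{−R/8}`, from any initial couplings. [ours] -/
theorem crnLag_replicas_median [Fact (Measurable w)] (hw0 : ∀ y, 0 < w y) {x₀ : Ω} (hmax : ∀ y, w y ≤ w x₀)
    [IsProbabilityMeasure (q.withDensity fun y => ENNReal.ofReal (w y))]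
    (Khat : Kernel (Ω × Ω) (Ω × Ω)) [IsMarkovKernel Khat]
    (hK : ∀ z : Ω × Ω, Khat z = (q.prod (volume : Measure unitInterval)).map (fun p : Ω × unitInterval =>
      ((if (p.2 : ℝ) * w z.1 ≤ w p.1 then p.1 else z.1), (if (p.2 : ℝ) * w z.2 ≤ w p.1 then p.1 else z.2))))
    {f : Ω → ℝ} (hf : Measurable f) {a c : ℝ} (ha : ∀ x, a ≤ f x) (hc : ∀ x, f x ≤ c) (k N : ℕ)
    (hZm : ∀ j, Measurable (Z j))
    (hlaw : ∀ j < R, μ.map (Z j) = Kernel.trajMeasure (X := fun _ : ℕ => Ω × Ω) (ν₀ j)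
      (fun n : ℕ => Khat.comap (fun h : (i : ↥(Finset.Iic n)) → Ω × Ω => h ⟨n, Finset.mem_Iic.2 le_rfl⟩)
        (measurable_pi_apply _)))
    (hind : iIndepFun Z μ) {s : ℝ} (hs : 0 < s)
    (hs2 : 4 * (∫ y, (f y - ∫ x, f x ∂(q.withDensity fun y => ENNReal.ofReal (w y))) ^ 2
          ∂(q.withDensity fun y => ENNReal.ofReal (w y)) +
        (1 - (w x₀)⁻¹) ^ k * (c - a) ^ 2 * (2 * w x₀ ^ 2 + w x₀ + 1)) ≤ s ^ 2) :
    μ.real {ω | (R : ℝ) / 2 ≤ #{j ∈ range R |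
        s ≤ |f ((Z j ω k).2) + ∑ n ∈ range N, (f ((Z j ω (k + n)).1) - f ((Z j ω (k + n)).2)) -
          ∫ x, f x ∂(q.withDensity fun y => ENNReal.ofReal (w y))|}} ≤ Real.exp (-(R / 8)) := by
  have hHm : Measurable fun z : ℕ → Ω × Ω => f ((z k).2) + ∑ n ∈ range N, (f ((z (k + n)).1) - f ((z (k + n)).2)) :=
    measurable_crnLagEstimator hf k N
  have hYm : ∀ j, Measurable fun ω => f ((Z j ω k).2) + ∑ n ∈ range N, (f ((Z j ω (k + n)).1) - f ((Z j ω (k + n)).2)) :=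
    fun j => hHm.comp (hZm j)
  have hY2 : ∀ j < R, MemLp (fun ω => f ((Z j ω k).2) + ∑ n ∈ range N, (f ((Z j ω (k + n)).1) - f ((Z j ω (k + n)).2))) 2 μ :=
    fun j _ => memLp_crnLag_replica hf ha hc k N hZm j
  have hYind : iIndepFun (fun j ω => f ((Z j ω k).2) + ∑ n ∈ range N, (f ((Z j ω (k + n)).1) - f ((Z j ω (k + n)).2))) μ :=
    hind.comp (fun _ => fun z : ℕ → Ω × Ω => f ((z k).2) + ∑ n ∈ range N, (f ((z (k + n)).1) - f ((z (k + n)).2)))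
      fun _ => hHm
  have hv : ∀ j < R, ∫ ω, (f ((Z j ω k).2) + ∑ n ∈ range N, (f ((Z j ω (k + n)).1) - f ((Z j ω (k + n)).2)) -
      ∫ x, f x ∂(q.withDensity fun y => ENNReal.ofReal (w y))) ^ 2 ∂μ ≤
      ∫ y, (f y - ∫ x, f x ∂(q.withDensity fun y => ENNReal.ofReal (w y))) ^ 2
          ∂(q.withDensity fun y => ENNReal.ofReal (w y)) +
        (1 - (w x₀)⁻¹) ^ k * (c - a) ^ 2 * (2 * w x₀ ^ 2 + w x₀ + 1) := fun j hj =>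
    crnLag_replica_sq_le hw0 hmax Khat hK hf ha hc k N hZm (hlaw j hj)
  exact measureReal_half_replicas_far_le_of_sq hYind hYm hY2 hs hs2 hv

end Replicas

end Summit.Ventures.LatticeQCDFlow.Exactness

end
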